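import Literature.Geometry.Lorentzian.CoordShrinkerCovRmNormSqDrift
import HarnessLib

/-!
# Route EntropyRung — registered helpers `helper_mwCovRmNormSqDriftGen`, `helper_mwCovRmNormSqBridgeGen`

Line `collapsed-ends-usc`, crux `EntropyRung.NoncompactShrinkerGap` (stmt-SmoothPoincare4-10868): the
`∇Rm`-equation inputs of the maximum-principle step in Munteanu–Wang 2015, Thm. 1.4, second half
(a complete 4-d gradient shrinker with bounded scalar curvature has bounded `|∇Rm|`), at chart
level. For metric components `G` with `Ric + Hess f = ½ G` on `V ⊆ E`, `dim E = 4`, positive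
definite at `x ∈ V`, and any basis `b` of `E`:
`Δ|∇Rm|² − d|∇Rm|²(∇f) ≥ 2|∇²Rm|² + 3|∇Rm|² − C(√|Rm|² + 1)|∇Rm|²` with the universal constant
`C = 84 · 4` (Munteanu–Wang's (u1), `Δ_f ∇Rm = (3/2)∇Rm + Rm ∗ ∇Rm`), Kato's inequality
`|∇|∇Rm|²|² ≤ 4|∇Rm|²|∇²Rm|²` and `0 ≤ |∇Rm|², |∇²Rm|²`; and the bridge to the orthonormal-frame sums
of `CoordShrinkerRmNormSqDrift.lean`: `|∇Rm|²_b = Σ G((∇_{e_k}R)(e_a,e_c)e_i,e_j)²`, `|Rm|²_b = rmNormSqAt`.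
All clauses are the Literature theorems `IsMetricOn.lapAt_tnormSq_tcov_rm4_sub_fderiv_ge_of_soliton`
(`Literature/Geometry/Lorentzian/CoordShrinkerCovRmNormSqDrift.lean`), `IsMetricOn.gradSqAt_tnormSq_le`
(`CoordCurvatureStarDerivatives.lean`), `tnormSq_nonneg`, `IsMetricOn.tnormSq_tcov_rm4_eq_sum_sq` and
`IsMetricOn.tnormSq_rm4_eq_rmNormSqAt_of_frame` (`CoordTensorStarBounds.lean`), specialised to
`λ = ½`, `n = 4`. No definition and no named fact is introduced.
-/

noncomputable section

-- the registered namespace `Summit.SmoothPoincare4.SmoothPoincare4.Theorems` repeats a component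
set_option linter.dupNamespace false

open scoped ContDiff Topology
open Set Filter Module Literature.Geometry.Lorentzian

namespace Summit.SmoothPoincare4.SmoothPoincare4.Theorems.NoncompactShrinkerGapMW

/-- **Registered helper `helper_mwCovRmNormSqDriftGen`** (stub of the lead's skeleton for crux
stmt-SmoothPoincare4-10868, line `collapsed-ends-usc`): on a 4-d gradient shrinker in a chart, in any
basis, `Δ_f |∇Rm|² ≥ 2|∇²Rm|² + 3|∇Rm|² − C(|Rm| + 1)|∇Rm|²` (`C = 336`), Kato
`|∇|∇Rm|²|² ≤ 4|∇Rm|²|∇²Rm|²`, and `|∇Rm|², |∇²Rm|² ≥ 0` (Munteanu–Wang 2015, proof of Thm. 1.4 and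
Prop. 2.2, (u1)). [cite: MunteanuWang2015, Thm. 1.4 (proof) and (u1)] -/
theorem helper_mwCovRmNormSqDriftGen : ∃ C : ℝ, ∀ {E : Type} [NormedAddCommGroup E] [NormedSpace ℝ E] [FiniteDimensional ℝ E] [CompleteSpace E] (G : E → E →L[ℝ] E →L[ℝ] ℝ) (V : Set E) (x : E) (f : E → ℝ) {ι : Type} [Fintype ι] [DecidableEq ι] (b : Module.Basis ι ℝ E), MetricCoord.IsMetricOn G V → x ∈ V → Module.finrank ℝ E = 4 → (∀ v : E, v ≠ 0 → 0 < G x v v) → ContDiffOn ℝ ∞ f V → (∀ y ∈ V, ∀ v w : E, MetricCoord.ricAt G y v w + MetricCoord.hessAt G f y v w = (1 / 2 : ℝ) * G y v w) → 2 * MetricCoord.tnormSq G b (MetricCoord.tcov G b (MetricCoord.tcov G b (MetricCoord.rm4 G b))) x + 3 * MetricCoord.tnormSq G b (MetricCoord.tcov G b (MetricCoord.rm4 G b)) x - C * (Real.sqrt (MetricCoord.rmNormSqAt G x) + 1) * MetricCoord.tnormSq G b (MetricCoord.tcov G b (MetricCoord.rm4 G b)) x ≤ MetricCoord.lapAt G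 (MetricCoord.tnormSq G b (MetricCoord.tcov G b (MetricCoord.rm4 G b))) x - fderiv ℝ (MetricCoord.tnormSq G b (MetricCoord.tcov G b (MetricCoord.rm4 G b))) x (MetricCoord.sharpAt G x (fderiv ℝ f x)) ∧ MetricCoord.gradSqAt G (MetricCoord.tnormSq G b (MetricCoord.tcov G b (MetricCoord.rm4 G b))) x ≤ 4 * MetricCoord.tnormSq G b (MetricCoord.tcov G b (MetricCoord.rm4 G b)) x * MetricCoord.tnormSq G b (MetricCoord.tcov G b (MetricCoord.tcov G b (MetricCoord.rm4 G b))) x ∧ 0 ≤ MetricCoord.tnormSq G b (MetricCoord.tcov G b (MetricCoord.rm4 G b)) x ∧ 0 ≤ MetricCoord.tnormSq G b (MetricCoord.tcov G b (MetricCoord.tcov G b (MetricCoord.rm4 G b))) x := by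
  refine ⟨84 * 4, ?_⟩
  intro E _ _ _ _ G V x f ι _ _ b hG hx h4 hpos hf hsol
  have hs := hG.symm x hx
  have hcard : (Fintype.card ι : ℝ) = 4 := by
    rw [← Module.finrank_eq_card_basis b, h4]; norm_num
  have hmain := hG.lapAt_tnormSq_tcov_rm4_sub_fderiv_ge_of_soliton b hx hpos hf hsol
  rw [hcard, hG.tnormSq_rm4_eq_rmNormSqAt b hx hpos] at hmain
  have hD1 : 0 ≤ MetricCoord.tnormSq G b (MetricCoord.tcov G b (MetricCoord.rm4 G b)) x :=
    MetricCoord.tnormSq_nonneg b hs hpos _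
  have hD2 : 0 ≤ MetricCoord.tnormSq G b (MetricCoord.tcov G b (MetricCoord.tcov G b (MetricCoord.rm4 G b))) x :=
    MetricCoord.tnormSq_nonneg b hs hpos _
  refine ⟨?_, hG.gradSqAt_tnormSq_le b hx hpos (hG.tsmoothOn_tcov (hG.tsmoothOn_rm4 b)), hD1, hD2⟩
  have hK0 : 0 ≤ Real.sqrt (MetricCoord.rmNormSqAt G x) := Real.sqrt_nonneg _
  nlinarith [hmain, hD1, hK0, mul_nonneg hD1 hK0]

/-- **Registered helper `helper_mwCovRmNormSqBridgeGen`**: for any basis `b` and any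
`G x`-orthonormal basis `e` of the 4-d chart model, `|∇Rm|²_b = Σ_{kacij} G((∇_{e_k}R)(e_a,e_c)e_i, e_j)²`
and `|Rm|²_b = rmNormSqAt G x` (the invariant norms of the component calculus are the frame sums of
`CoordShrinkerRmNormSqDrift.lean`). [cite: Topping2006, §3.2, p. 37] -/
theorem helper_mwCovRmNormSqBridgeGen : ∀ {E : Type} [NormedAddCommGroup E] [NormedSpace ℝ E] [FiniteDimensional ℝ E] [CompleteSpace E] (G : E → E →L[ℝ] E →L[ℝ] ℝ) (V : Set E) (x : E) {ι : Type} [Fintype ι] [DecidableEq ι] (b : Module.Basis ι ℝ E) (e : Module.Basis (Fin 4) ℝ E), MetricCoord.IsMetricOn G V → x ∈ V → Module.finrank ℝ E = 4 → (∀ i j, G x (e i) (e j) = if i = j then 1 else 0) → MetricCoord.tnormSq G b (MetricCoord.tcov G b (MetricCoord.rm4 G b)) x = ∑ k, ∑ a, ∑ c, ∑ i, ∑ j, (G x (MetricCoord.covRiemAt G x (e k) (e a) (e c) (e i)) (e j)) ^ 2 ∧ MetricCoord.tnormSq G b (MetricCoord.rm4 G b) x = MetricCoord.rmNormSqAt G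 x := by
  intro E _ _ _ _ G V x ι _ _ b e hG hx h4 he
  exact ⟨hG.tnormSq_tcov_rm4_eq_sum_sq b hx e he, hG.tnormSq_rm4_eq_rmNormSqAt_of_frame b hx e he⟩

end Summit.SmoothPoincare4.SmoothPoincare4.Theorems.NoncompactShrinkerGapMW

end
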